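import Literature.Geometry.Lorentzian.KerrTimeDerivative
import HarnessLib

/-!
# Local energy decay on subextremal Kerr from integrated local energy decay
# (Dafermos–Rodnianski–Shlapentokh-Rothman, Thm. 3.2 ⟹ `E_loc(τ, R) → 0`)

(family `gr`, statement **gr.S24**; namespace `Literature.Geometry.Lorentzian`)

`BlackHoles.lean` vendors the qualitative local energy decay statement
`drsr_wave_local_energy_decay_kerr` (for `|a| < M` and every admissible wave `ψ`, the coordinate
energy `E_loc(τ, R)` through `{t* = τ} ∩ {r > r₊} ∩ {‖y‖ ≤ R}` tends to `0` as `τ → ∞`;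
Dafermos–Rodnianski–Shlapentokh-Rothman, arXiv:1402.7034 = Ann. of Math. 183 (2016), Cor. 3.1)
and proves it from the polynomial bound `drsr_wave_polynomial_decay_kerr`, which
`KerrHyperboloidalFlux.lean` reduces to Cor. 3.1 in flux form through a hyperboloidal foliation
(named fact `Kerr.drsr_corollary_3_1_scri_flux_decay`); Cor. 3.1 in turn rests on the `r^p`
"black box" of Dafermos–Rodnianski (arXiv:0910.4957). This file gives a **second, independent
derivation from DRSR's Theorem 3.2** — the higher-order integrated local energy decay estimate
(25), proved in that paper (§§9–11), vendored in local form as the named fact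
`drsr_wave_integrated_decay_kerr` of `KerrWaveDecay.lean`
(`∫₀^∞ E_loc(τ, R) dτ ≤ C(M, a, R) · E₂[ψ](0)`):

* `drsr_wave_local_energy_decay_kerr_of_integrated_decay :
    drsr_wave_integrated_decay_kerr → drsr_wave_local_energy_decay_kerr` (**proved**).

The argument is the classical passage from integrated to pointwise-in-time decay, for which
`KerrWaveDecay.lean` recorded only the statement-level consequence
`drsr_wave_integrated_decay_kerr.frequently_lt` ("together with a local-in-time energy
inequality this is the classical route to `E_loc(τ, R) → 0`"). No energy estimate is needed:

1. `tendsto_zero_of_le_add_lintegral` — if `f, g : ℝ → [0, ∞]` have finite integrals on `(0, ∞)`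
   and `f(τ₂) ≤ f(τ₁) + ∫_{τ₁}^{τ₂} (f + g)` for `0 < τ₁ ≤ τ₂`, then `f(τ) → 0` (on `[τ − 1, τ]`
   the function `f` dips below `ε/2`, and the increment from there is a tail integral);
   `lintegral_Ioi_eq_tsum`, `exists_lintegral_Ioi_lt` (tails of finite integrals are small, by
   countable additivity over `(n, n + 1]` — no measurability needed).
2. `coordEnergyDensity_le_add_lintegral` — for smooth `ψ` and a slice point `y`, the density
   `e(t) = ∑_μ (∂_μψ̃)²(t, y)` has `e' = 2 ∑_μ ∂_μψ̃ ∂_μ(Tψ)~ ≤ e[ψ] + e[Tψ]` (the partial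
   derivatives commute, `KerrTimeDerivative.lean`), so `e(τ₂) ≤ e(τ₁) + ∫_{τ₁}^{τ₂} (e[ψ] + e[Tψ])`
   by the fundamental theorem of calculus.
3. `localSliceEnergy_le_add_lintegral` — integrating over the coordinate ball and exchanging the
   integrals (Tonelli, with the measurability of `KerrTimeDerivative.lean`):
   `E_loc[ψ](τ₂, R) ≤ E_loc[ψ](τ₁, R) + ∫_{τ₁}^{τ₂} (E_loc[ψ] + E_loc[Tψ])(t, R) dt`.
4. Integrated decay for `ψ` and for the admissible wave `Tψ` (`IsAdmissibleKerrWave.timeDeriv`),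
   both with finite second-order initial energy
   (`IsAdmissibleKerrWave.sliceSobolevEnergy_two_lt_top`), makes `f = E_loc[ψ](·, R)` and
   `g = E_loc[Tψ](·, R)` integrable on `(0, ∞)`, and step 1 applies.

Thus the trust base of `drsr_wave_local_energy_decay_kerr` along this route is the single named
fact `drsr_wave_integrated_decay_kerr` (DRSR Thm. 3.2 (25), `j = 2`, local consequence form; see
the docstring of that fact for the identification with the printed estimate).

## References

* M. Dafermos, I. Rodnianski, Y. Shlapentokh-Rothman, *Decay for solutions of the wave equation
  on Kerr exterior spacetimes III: the full subextremal case `|a| < M`*, Ann. of Math. 183 (2016)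
  787–913, arXiv:1402.7034: §3.2 Thm. 3.2 (25), §3.3 Cor. 3.1, §3.4 (logic of the proof)
  (key `DafermosRodnianskiShlapentokhrothman2014`).
* M. Dafermos, I. Rodnianski, *Lectures on black holes and linear waves*, arXiv:0811.0354, §4
  (local energies) (key `DafermosRodnianski2008`).
-/

noncomputable section

open Set Filter
open scoped Topology Manifold ContDiff

namespace Literature.Geometry.Lorentzian

section RealAnalysis

open MeasureTheory
open scoped ENNReal

/-! ### A real-analysis lemma: integrable functions with integrable increments tend to zero -/

/-- `(T, ∞) = ⋃ₙ (T + n, T + n + 1]`. [folklore] -/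
theorem iUnion_Ioc_add_natCast (T : ℝ) : ⋃ n : ℕ, Ioc (T + n) (T + n + 1) = Ioi T := by
  ext x
  simp only [mem_iUnion, mem_Ioc, mem_Ioi]
  constructor
  · rintro ⟨n, hn, -⟩
    exact lt_of_le_of_lt (by simp) hn
  · intro hx
    refine ⟨⌈x - T⌉₊ - 1, ?_, ?_⟩
    · have h1 : (1 : ℕ) ≤ ⌈x - T⌉₊ := Nat.one_le_iff_ne_zero.mpr (by
        rw [Ne, Nat.ceil_eq_zero]; linarith)
      have h2 : (⌈x - T⌉₊ : ℝ) < x - T + 1 := Nat.ceil_lt_add_one (by linarith)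
      rw [Nat.cast_sub h1, Nat.cast_one]
      linarith
    · have h3 : x - T ≤ ⌈x - T⌉₊ := Nat.le_ceil _
      have h1 : (1 : ℕ) ≤ ⌈x - T⌉₊ := Nat.one_le_iff_ne_zero.mpr (by
        rw [Ne, Nat.ceil_eq_zero]; linarith)
      rw [Nat.cast_sub h1, Nat.cast_one]
      linarith

/-- The intervals `(T + n, T + n + 1]`, `n ∈ ℕ`, are pairwise disjoint. [folklore] -/
theorem pairwise_disjoint_Ioc_add_natCast (T : ℝ) :
    Pairwise (Function.onFun Disjoint fun n : ℕ ↦ Ioc (T + n) (T + n + 1)) := by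
  intro m n hmn
  simp only [Function.onFun]
  rw [Set.disjoint_iff]
  rintro x ⟨⟨hm1, hm2⟩, ⟨hn1, hn2⟩⟩
  apply hmn
  have i1 : (m : ℝ) < n + 1 := by linarith
  have i2 : (n : ℝ) < m + 1 := by linarith
  have j1 : m < n + 1 := by exact_mod_cast i1
  have j2 : n < m + 1 := by exact_mod_cast i2
  omega

/-- `∫_{(T,∞)} h = ∑ₙ ∫_{(T+n, T+n+1]} h` (countable additivity; no measurability of `h` needed).
[folklore] -/
theorem lintegral_Ioi_eq_tsum (h : ℝ → ℝ≥0∞) (T : ℝ) :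
    ∫⁻ t in Ioi T, h t = ∑' n : ℕ, ∫⁻ t in Ioc (T + n) (T + n + 1), h t := by
  rw [← iUnion_Ioc_add_natCast T,
    lintegral_iUnion (fun _ ↦ measurableSet_Ioc) (pairwise_disjoint_Ioc_add_natCast T)]

/-- If `∫_{(0,∞)} h < ∞` then the tails `∫_{(N,∞)} h` become smaller than any `ε > 0`.
[folklore] -/
theorem exists_lintegral_Ioi_lt (h : ℝ → ℝ≥0∞) (hfin : ∫⁻ t in Ioi (0 : ℝ), h t ≠ ⊤) {ε : ℝ≥0∞}
    (hε : 0 < ε) : ∃ N : ℕ, ∫⁻ t in Ioi (N : ℝ), h t < ε := by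
  set a : ℕ → ℝ≥0∞ := fun n ↦ ∫⁻ t in Ioc ((0 : ℝ) + n) (0 + n + 1), h t with ha
  have hsum : ∑' n, a n = ∫⁻ t in Ioi (0 : ℝ), h t := (lintegral_Ioi_eq_tsum h 0).symm
  have htail : ∀ N : ℕ, ∫⁻ t in Ioi (N : ℝ), h t = ∑' k, a (k + N) := by
    intro N
    rw [lintegral_Ioi_eq_tsum h N]
    refine tsum_congr fun k ↦ ?_
    simp only [ha, Nat.cast_add, zero_add]
    congr 2; ring
  have hlim : Tendsto (fun N : ℕ ↦ ∑' k, a (k + N)) atTop (𝓝 0) :=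
    ENNReal.tendsto_sum_nat_add a (hsum ▸ hfin)
  obtain ⟨N, hN⟩ := (hlim.eventually (gt_mem_nhds hε)).exists
  exact ⟨N, (htail N).symm ▸ hN⟩

/-- **A nonnegative integrable function whose increments are controlled by an integrable rate
tends to zero.** If `f, g : ℝ → [0, ∞]` have finite integrals over `(0, ∞)`, `f` is measurable,
and `f(τ₂) ≤ f(τ₁) + ∫_{τ₁}^{τ₂} (f + g)` for `0 < τ₁ ≤ τ₂`, then `f(τ) → 0` as `τ → ∞`: on
`[τ − 1, τ]` the function `f` takes a value `< ε/2` somewhere (its integral there is small), and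
the increment from there to `τ` is at most a tail integral of `f + g`. (The classical step from
integrated local energy decay to pointwise-in-time local energy decay.) [folklore] -/
theorem tendsto_zero_of_le_add_lintegral {f g : ℝ → ℝ≥0∞} (hfm : Measurable f)
    (hf : ∫⁻ t in Ioi (0 : ℝ), f t ≠ ⊤) (hg : ∫⁻ t in Ioi (0 : ℝ), g t ≠ ⊤)
    (hle : ∀ τ₁ τ₂ : ℝ, 0 < τ₁ → τ₁ ≤ τ₂ → f τ₂ ≤ f τ₁ + ∫⁻ t in Icc τ₁ τ₂, (f t + g t)) :
    Tendsto f atTop (𝓝 0) := by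
  rw [ENNReal.tendsto_nhds_zero]
  intro ε hε
  have hh : ∫⁻ t in Ioi (0 : ℝ), (f t + g t) ≠ ⊤ := by
    rw [lintegral_add_left hfm]
    exact ENNReal.add_ne_top.mpr ⟨hf, hg⟩
  have hε2 : 0 < ε / 2 := ENNReal.half_pos hε.ne'
  obtain ⟨N, hN⟩ := exists_lintegral_Ioi_lt (fun t ↦ f t + g t) hh hε2
  filter_upwards [eventually_gt_atTop ((N : ℝ) + 1)] with τ hτ
  -- a point of `[τ - 1, τ]` where `f` is small
  have hsub : Icc (τ - 1) τ ⊆ Ioi (N : ℝ) := fun t ht ↦ by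
    simp only [mem_Ioi]; linarith [ht.1]
  obtain ⟨τ₁, hτ₁, hf₁⟩ : ∃ τ₁ ∈ Icc (τ - 1) τ, f τ₁ < ε / 2 := by
    by_contra hcon
    push Not at hcon
    have h1 : ε / 2 ≤ ∫⁻ t in Icc (τ - 1) τ, f t := by
      calc ε / 2 = ε / 2 * volume (Icc (τ - 1) τ) := by
            rw [Real.volume_Icc, show τ - (τ - 1) = 1 by ring, ENNReal.ofReal_one, mul_one]
        _ = ∫⁻ _ in Icc (τ - 1) τ, ε / 2 := (setLIntegral_const _ _).symm
        _ ≤ ∫⁻ t in Icc (τ - 1) τ, f t := setLIntegral_mono' measurableSet_Icc hcon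
    have h2 : ∫⁻ t in Icc (τ - 1) τ, f t < ε / 2 :=
      calc ∫⁻ t in Icc (τ - 1) τ, f t ≤ ∫⁻ t in Icc (τ - 1) τ, (f t + g t) :=
            lintegral_mono fun t ↦ le_self_add
        _ ≤ ∫⁻ t in Ioi (N : ℝ), (f t + g t) := lintegral_mono_set hsub
        _ < ε / 2 := hN
    exact (lt_irrefl _) (h1.trans_lt h2)
  have hτ₁pos : 0 < τ₁ := by
    have := hτ₁.1; have hN0 : (0 : ℝ) ≤ N := N.cast_nonneg; linarith
  calc f τ ≤ f τ₁ + ∫⁻ t in Icc τ₁ τ, (f t + g t) := hle τ₁ τ hτ₁pos hτ₁.2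
    _ ≤ ε / 2 + ∫⁻ t in Ioi (N : ℝ), (f t + g t) :=
        add_le_add hf₁.le (lintegral_mono_set fun t ht ↦ hsub ⟨hτ₁.1.trans ht.1, ht.2⟩)
    _ ≤ ε / 2 + ε / 2 := by gcongr
    _ = ε := ENNReal.add_halves ε

end RealAnalysis

open MeasureTheory
open scoped ENNReal

/-! ### The local energy inequality in time -/

/-- Partial derivatives of (the representative of) a smooth function on a chart domain are
continuous along the time lines `t ↦ (t, y)` through the domain. [folklore] -/
theorem continuous_fderiv_extend_comp_ofTimeSpace {a r₀ : ℝ} {χ : Kerr.region a r₀ → ℝ}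
    (hχ : ContMDiff 𝓘(ℝ, E4) 𝓘(ℝ, ℝ) ∞ χ) {y : E3} (hy : y ∈ Kerr.slice a r₀) (v : E4) :
    Continuous fun t : ℝ ↦
      fderiv ℝ (Function.extend Subtype.val χ 0) (E4.ofTimeSpace t y) v := by
  have hmem : ∀ t, E4.ofTimeSpace t y ∈ Kerr.region a r₀ := fun t ↦
    Kerr.ofTimeSpace_mem_region_iff.2 hy
  refine continuous_iff_continuousAt.2 fun t ↦ ?_
  have h1 : ContinuousAt (fun z ↦ fderiv ℝ (Function.extend Subtype.val χ 0) z v)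
      (E4.ofTimeSpace t y) :=
    (contDiffAt_fderiv_apply_const (n := 0)
      ((contDiffAt_extend hχ ⟨_, hmem t⟩).of_le (by norm_cast)) v).continuousAt
  exact ContinuousAt.comp (f := fun t ↦ E4.ofTimeSpace t y) h1
    (continuous_ofTimeSpace_left y).continuousAt

/-- **Pointwise local energy inequality in time.** For a smooth `ψ` on a chart domain and a point
`y` of the slice, the coordinate energy density `e(t) = ∑_μ (∂_μψ̃)²(t, y)` satisfies
`e(τ₂) ≤ e(τ₁) + ∫_{τ₁}^{τ₂} (e[ψ] + e[Tψ])(t) dt` for `τ₁ ≤ τ₂`: indeed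
`e' = 2 ∑_μ ∂_μψ̃ · ∂_μ(∂_0ψ̃) ≤ e[ψ] + e[Tψ]` (Cauchy–Schwarz), and the fundamental theorem of
calculus. (The elementary substitute for a local-in-time energy estimate on the way from
integrated to pointwise-in-time local energy decay.) [folklore] -/
theorem coordEnergyDensity_le_add_lintegral {a r₀ : ℝ} {ψ : Kerr.region a r₀ → ℝ}
    (hψ : ContMDiff 𝓘(ℝ, E4) 𝓘(ℝ, ℝ) ∞ ψ) {y : E3} (hy : y ∈ Kerr.slice a r₀) {τ₁ τ₂ : ℝ}
    (h12 : τ₁ ≤ τ₂) :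
    ENNReal.ofReal (coordEnergyDensity (Kerr.region a r₀) ψ (E4.ofTimeSpace τ₂ y)) ≤
      ENNReal.ofReal (coordEnergyDensity (Kerr.region a r₀) ψ (E4.ofTimeSpace τ₁ y)) +
        ∫⁻ t in Icc τ₁ τ₂,
          (ENNReal.ofReal (coordEnergyDensity (Kerr.region a r₀) ψ (E4.ofTimeSpace t y)) +
            ENNReal.ofReal
              (coordEnergyDensity (Kerr.region a r₀) (timeDeriv ψ) (E4.ofTimeSpace t y))) := by
  set Φ : E4 → ℝ := Function.extend Subtype.val ψ 0 with hΦ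
  set Ψ : E4 → ℝ := Function.extend Subtype.val (timeDeriv ψ) 0 with hΨ
  have hmem : ∀ t, E4.ofTimeSpace t y ∈ Kerr.region a r₀ := fun t ↦
    Kerr.ofTimeSpace_mem_region_iff.2 hy
  -- the time lines and their velocity
  have hp : ∀ t : ℝ, HasDerivAt (fun t : ℝ ↦ E4.ofTimeSpace t y) (E4.basisVector 0) t := by
    intro t
    have h : (fun t : ℝ ↦ E4.ofTimeSpace t y) = fun t ↦ t • E4.basisVector 0 + E4.spaceEmbed y :=
      funext fun t ↦ E4.ofTimeSpace_eq_smul_add' t y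
    rw [h]
    simpa using ((hasDerivAt_id t).smul_const (E4.basisVector 0)).add_const (E4.spaceEmbed y)
  -- the components `f_μ(t) = ∂_μψ̃(t, y)` and `g_μ(t) = ∂_μ(Tψ)~(t, y)`
  set f : Fin 4 → ℝ → ℝ := fun μ t ↦ fderiv ℝ Φ (E4.ofTimeSpace t y) (E4.basisVector μ) with hf
  set g : Fin 4 → ℝ → ℝ := fun μ t ↦ fderiv ℝ Ψ (E4.ofTimeSpace t y) (E4.basisVector μ) with hg
  have hsmooth : ∀ t, ContDiffAt ℝ ∞ Φ (E4.ofTimeSpace t y) := fun t ↦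
    contDiffAt_extend hψ ⟨_, hmem t⟩
  -- `f_μ' = g_μ`
  have hkey : ∀ μ t, HasDerivAt (f μ) (g μ t) t := by
    intro μ t
    have h2 : ContDiffAt ℝ 2 Φ (E4.ofTimeSpace t y) := (hsmooth t).of_le (by norm_cast)
    have hF : HasFDerivAt (fun z ↦ fderiv ℝ Φ z (E4.basisVector μ))
        (fderiv ℝ (fun z ↦ fderiv ℝ Φ z (E4.basisVector μ)) (E4.ofTimeSpace t y))
        (E4.ofTimeSpace t y) :=
      ((contDiffAt_fderiv_apply_const (n := 1) (by exact_mod_cast h2) _).differentiableAt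
        one_ne_zero).hasFDerivAt
    have hc := hF.comp_hasDerivAt t (hp t)
    have hval : fderiv ℝ (fun z ↦ fderiv ℝ Φ z (E4.basisVector μ)) (E4.ofTimeSpace t y)
        (E4.basisVector 0) = g μ t := by
      rw [fderiv_fderiv_apply_comm h2, hg]
      simp only [hΨ]
      rw [fderiv_extend_timeDeriv ψ ⟨_, hmem t⟩]
    rw [hval] at hc
    exact hc
  -- the energy density `e = ∑ f_μ²` and its derivative
  have he : ∀ t, HasDerivAt (fun t ↦ ∑ μ, f μ t ^ 2) (∑ μ, 2 * f μ t * g μ t) t := by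
    intro t
    have := HasDerivAt.fun_sum fun μ (_ : μ ∈ Finset.univ) ↦ (hkey μ t).pow 2
    simpa [pow_one, mul_comm, mul_left_comm, mul_assoc] using this
  have hcont_f : ∀ μ, Continuous (f μ) := fun μ ↦ by
    simpa only [hf, hΦ] using continuous_fderiv_extend_comp_ofTimeSpace hψ hy (E4.basisVector μ)
  have hcont_g : ∀ μ, Continuous (g μ) := fun μ ↦ by
    simpa only [hg, hΨ] using
      continuous_fderiv_extend_comp_ofTimeSpace (contMDiff_timeDeriv hψ) hy (E4.basisVector μ)
  have hcont_e' : Continuous fun t ↦ ∑ μ, 2 * f μ t * g μ t := by fun_prop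
  have hcont_e : Continuous fun t ↦ ∑ μ, f μ t ^ 2 := by fun_prop
  have hcont_eT : Continuous fun t ↦ ∑ μ, g μ t ^ 2 := by fun_prop
  -- `e' ≤ e + e_T`
  have hle : ∀ t, ∑ μ, 2 * f μ t * g μ t ≤ ∑ μ, f μ t ^ 2 + ∑ μ, g μ t ^ 2 := by
    intro t
    rw [← Finset.sum_add_distrib]
    exact Finset.sum_le_sum fun μ _ ↦ two_mul_le_add_sq (f μ t) (g μ t)
  -- fundamental theorem of calculus
  have hftc : ∫ t in τ₁..τ₂, ∑ μ, 2 * f μ t * g μ t =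
      ∑ μ, f μ τ₂ ^ 2 - ∑ μ, f μ τ₁ ^ 2 :=
    intervalIntegral.integral_eq_sub_of_hasDerivAt (fun t _ ↦ he t)
      (hcont_e'.intervalIntegrable _ _)
  have hmono : ∫ t in τ₁..τ₂, ∑ μ, 2 * f μ t * g μ t ≤
      ∫ t in τ₁..τ₂, (∑ μ, f μ t ^ 2 + ∑ μ, g μ t ^ 2) :=
    intervalIntegral.integral_mono_on h12 (hcont_e'.intervalIntegrable _ _)
      ((hcont_e.add hcont_eT).intervalIntegrable _ _) fun t _ ↦ hle t
  have hnn : ∀ t, 0 ≤ ∑ μ, f μ t ^ 2 + ∑ μ, g μ t ^ 2 := fun t ↦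
    add_nonneg (Finset.sum_nonneg fun _ _ ↦ sq_nonneg _) (Finset.sum_nonneg fun _ _ ↦ sq_nonneg _)
  -- identification of the densities
  have heq : ∀ t, coordEnergyDensity (Kerr.region a r₀) ψ (E4.ofTimeSpace t y) =
      ∑ μ, f μ t ^ 2 := fun t ↦
    (Kerr.sum_sq_fderiv_extend_eq (Kerr.region a r₀) ψ _).symm
  have heqT : ∀ t, coordEnergyDensity (Kerr.region a r₀) (timeDeriv ψ) (E4.ofTimeSpace t y) =
      ∑ μ, g μ t ^ 2 := fun t ↦
    (Kerr.sum_sq_fderiv_extend_eq (Kerr.region a r₀) (timeDeriv ψ) _).symm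
  simp only [heq, heqT]
  -- the real inequality
  have hreal : ∑ μ, f μ τ₂ ^ 2 ≤ ∑ μ, f μ τ₁ ^ 2 +
      ∫ t in τ₁..τ₂, (∑ μ, f μ t ^ 2 + ∑ μ, g μ t ^ 2) := by linarith
  -- pass to `ℝ≥0∞`
  have hint : IntegrableOn (fun t ↦ ∑ μ, f μ t ^ 2 + ∑ μ, g μ t ^ 2) (Ioc τ₁ τ₂) :=
    ((hcont_e.add hcont_eT).integrableOn_Icc).mono_set Ioc_subset_Icc_self
  calc ENNReal.ofReal (∑ μ, f μ τ₂ ^ 2)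
      ≤ ENNReal.ofReal (∑ μ, f μ τ₁ ^ 2 +
          ∫ t in τ₁..τ₂, (∑ μ, f μ t ^ 2 + ∑ μ, g μ t ^ 2)) := ENNReal.ofReal_le_ofReal hreal
    _ ≤ ENNReal.ofReal (∑ μ, f μ τ₁ ^ 2) +
          ENNReal.ofReal (∫ t in τ₁..τ₂, (∑ μ, f μ t ^ 2 + ∑ μ, g μ t ^ 2)) :=
        ENNReal.ofReal_add_le
    _ = ENNReal.ofReal (∑ μ, f μ τ₁ ^ 2) +
          ∫⁻ t in Ioc τ₁ τ₂, ENNReal.ofReal (∑ μ, f μ t ^ 2 + ∑ μ, g μ t ^ 2) := by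
        rw [intervalIntegral.integral_of_le h12,
          ofReal_integral_eq_lintegral_ofReal hint (ae_of_all _ hnn)]
    _ ≤ ENNReal.ofReal (∑ μ, f μ τ₁ ^ 2) +
          ∫⁻ t in Icc τ₁ τ₂,
            (ENNReal.ofReal (∑ μ, f μ t ^ 2) + ENNReal.ofReal (∑ μ, g μ t ^ 2)) := by
        gcongr ?_ + ?_
        · exact le_rfl
        · refine (lintegral_mono_set Ioc_subset_Icc_self).trans (lintegral_mono fun t ↦ ?_)
          rw [ENNReal.ofReal_add (Finset.sum_nonneg fun _ _ ↦ sq_nonneg _)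
            (Finset.sum_nonneg fun _ _ ↦ sq_nonneg _)]

/-- **Local energy inequality in time, integrated form.** For a smooth `ψ` on a Kerr–Schild chart
domain, `E_loc[ψ](τ₂, R) ≤ E_loc[ψ](τ₁, R) + ∫_{τ₁}^{τ₂} (E_loc[ψ](t, R) + E_loc[Tψ](t, R)) dt`
for `τ₁ ≤ τ₂` (integrate the pointwise inequality over the coordinate ball and exchange the
integrals by Tonelli). [folklore] -/
theorem localSliceEnergy_le_add_lintegral {a r₀ : ℝ} {ψ : Kerr.region a r₀ → ℝ}
    (hψ : ContMDiff 𝓘(ℝ, E4) 𝓘(ℝ, ℝ) ∞ ψ) (R : ℝ) {τ₁ τ₂ : ℝ} (h12 : τ₁ ≤ τ₂) :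
    localSliceEnergy (Kerr.region a r₀) ψ τ₂ R ≤ localSliceEnergy (Kerr.region a r₀) ψ τ₁ R +
      ∫⁻ t in Icc τ₁ τ₂, (localSliceEnergy (Kerr.region a r₀) ψ t R +
        localSliceEnergy (Kerr.region a r₀) (timeDeriv ψ) t R) := by
  have hF := measurable_energyIntegrand (Kerr.region a r₀) ψ
  have hFT := measurable_energyIntegrand (Kerr.region a r₀) (timeDeriv ψ)
  rw [localSliceEnergy_eq_lintegral_energyIntegrand, localSliceEnergy_eq_lintegral_energyIntegrand]
  have hrw : (fun t ↦ localSliceEnergy (Kerr.region a r₀) ψ t R +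
      localSliceEnergy (Kerr.region a r₀) (timeDeriv ψ) t R) =
      fun t ↦ (∫⁻ y in Metric.closedBall (0 : E3) R, energyIntegrand (Kerr.region a r₀) ψ (t, y)) +
        ∫⁻ y in Metric.closedBall (0 : E3) R,
          energyIntegrand (Kerr.region a r₀) (timeDeriv ψ) (t, y) :=
    rfl
  rw [hrw]
  -- pointwise in `y`
  have hpt : ∀ y : E3, energyIntegrand (Kerr.region a r₀) ψ (τ₂, y) ≤
      energyIntegrand (Kerr.region a r₀) ψ (τ₁, y) +
        ∫⁻ t in Icc τ₁ τ₂, (energyIntegrand (Kerr.region a r₀) ψ (t, y) +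
          energyIntegrand (Kerr.region a r₀) (timeDeriv ψ) (t, y)) := by
    intro y
    by_cases hy : y ∈ Kerr.slice a r₀
    · have hmem : ∀ t, E4.ofTimeSpace t y ∈ Kerr.region a r₀ := fun t ↦
        Kerr.ofTimeSpace_mem_region_iff.2 hy
      rw [energyIntegrand_of_mem _ ψ (hmem τ₂), energyIntegrand_of_mem _ ψ (hmem τ₁)]
      have hint : (fun t ↦ energyIntegrand (Kerr.region a r₀) ψ (t, y) +
          energyIntegrand (Kerr.region a r₀) (timeDeriv ψ) (t, y)) =
          fun t ↦ ENNReal.ofReal (coordEnergyDensity (Kerr.region a r₀) ψ (E4.ofTimeSpace t y)) +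
            ENNReal.ofReal
              (coordEnergyDensity (Kerr.region a r₀) (timeDeriv ψ) (E4.ofTimeSpace t y)) :=
        funext fun t ↦ by
          rw [energyIntegrand_of_mem _ ψ (hmem t), energyIntegrand_of_mem _ (timeDeriv ψ) (hmem t)]
      rw [hint]
      exact coordEnergyDensity_le_add_lintegral hψ hy h12
    · have hnmem : E4.ofTimeSpace τ₂ y ∉ Kerr.region a r₀ := fun h ↦
        hy (Kerr.ofTimeSpace_mem_region_iff.1 h)
      rw [energyIntegrand_of_not_mem _ ψ hnmem]
      exact zero_le
  have hswap_meas : AEMeasurable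
      (Function.uncurry fun (y : E3) (t : ℝ) ↦
        energyIntegrand (Kerr.region a r₀) ψ (t, y) +
          energyIntegrand (Kerr.region a r₀) (timeDeriv ψ) (t, y))
      ((volume.restrict (Metric.closedBall (0 : E3) R)).prod (volume.restrict (Icc τ₁ τ₂))) :=
    ((hF.add hFT).comp measurable_swap).aemeasurable
  calc ∫⁻ y in Metric.closedBall (0 : E3) R, energyIntegrand (Kerr.region a r₀) ψ (τ₂, y)
      ≤ ∫⁻ y in Metric.closedBall (0 : E3) R, (energyIntegrand (Kerr.region a r₀) ψ (τ₁, y) +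
          ∫⁻ t in Icc τ₁ τ₂, (energyIntegrand (Kerr.region a r₀) ψ (t, y) +
            energyIntegrand (Kerr.region a r₀) (timeDeriv ψ) (t, y))) :=
        lintegral_mono hpt
    _ = (∫⁻ y in Metric.closedBall (0 : E3) R, energyIntegrand (Kerr.region a r₀) ψ (τ₁, y)) +
          ∫⁻ y in Metric.closedBall (0 : E3) R, ∫⁻ t in Icc τ₁ τ₂,
            (energyIntegrand (Kerr.region a r₀) ψ (t, y) +
              energyIntegrand (Kerr.region a r₀) (timeDeriv ψ) (t, y)) :=
        lintegral_add_left (hF.comp measurable_prodMk_left) _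
    _ = (∫⁻ y in Metric.closedBall (0 : E3) R, energyIntegrand (Kerr.region a r₀) ψ (τ₁, y)) +
          ∫⁻ t in Icc τ₁ τ₂, ∫⁻ y in Metric.closedBall (0 : E3) R,
            (energyIntegrand (Kerr.region a r₀) ψ (t, y) +
              energyIntegrand (Kerr.region a r₀) (timeDeriv ψ) (t, y)) := by
        rw [lintegral_lintegral_swap hswap_meas]
    _ = (∫⁻ y in Metric.closedBall (0 : E3) R, energyIntegrand (Kerr.region a r₀) ψ (τ₁, y)) +
          ∫⁻ t in Icc τ₁ τ₂,
            ((∫⁻ y in Metric.closedBall (0 : E3) R, energyIntegrand (Kerr.region a r₀) ψ (t, y)) +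
              ∫⁻ y in Metric.closedBall (0 : E3) R,
                energyIntegrand (Kerr.region a r₀) (timeDeriv ψ) (t, y)) := by
        congr 1
        exact lintegral_congr fun t ↦ lintegral_add_left (hF.comp measurable_prodMk_left) _

/-! ### Local energy decay from integrated local energy decay -/

/-- **DRSR's local energy decay from their integrated local energy decay (Thm. 3.2).** The named
fact `drsr_wave_integrated_decay_kerr` (`KerrWaveDecay.lean`: Dafermos–Rodnianski–
Shlapentokh-Rothman, arXiv:1402.7034 = Ann. of Math. 183 (2016), Thm. 3.2, estimate (25) with
`j = 2`, local consequence `∫₀^∞ E_loc(τ, R) dτ ≤ C · E₂[ψ](0)`) implies the named fact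
`drsr_wave_local_energy_decay_kerr` of `BlackHoles.lean` (`E_loc(τ, R) → 0`): apply integrated
decay to `ψ` and to the admissible wave `Tψ` (`IsAdmissibleKerrWave.timeDeriv`), whose initial
second-order energies are finite (`IsAdmissibleKerrWave.sliceSobolevEnergy_two_lt_top`), and
combine with the local energy inequality in time (`localSliceEnergy_le_add_lintegral`) through
`tendsto_zero_of_le_add_lintegral`. This is the classical route from integrated to pointwise-in-time
local energy decay; it makes `drsr_wave_local_energy_decay_kerr` rest on DRSR's Theorem 3.2
(proved in that paper) rather than on Corollary 3.1 (which invokes the `r^p` method).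
[cite: DafermosRodnianskiShlapentokhrothman2014, Thm. 3.2 (25)] -/
theorem drsr_wave_local_energy_decay_kerr_of_integrated_decay
    (h : drsr_wave_integrated_decay_kerr) : drsr_wave_local_energy_decay_kerr := by
  intro _ _ M a hMa ψ hψ R
  have hM : 0 ≤ M := hMa.pos.le
  obtain ⟨C, hC, hb⟩ := h M a hMa R
  have hT : IsAdmissibleKerrWave M a (timeDeriv ψ) := hψ.timeDeriv hM
  have hfin : ∀ φ : Kerr.exterior M a → ℝ, IsAdmissibleKerrWave M a φ →
      ∫⁻ τ in Ioi (0 : ℝ), localSliceEnergy (Kerr.exterior M a) φ τ R ≠ ⊤ := fun φ hφ ↦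
    ((hb φ hφ).trans_lt
      (ENNReal.mul_lt_top hC (hφ.sliceSobolevEnergy_two_lt_top hM))).ne
  exact tendsto_zero_of_le_add_lintegral (measurable_localSliceEnergy _ ψ R) (hfin ψ hψ)
    (hfin _ hT) fun τ₁ τ₂ _ h12 ↦ localSliceEnergy_le_add_lintegral hψ.1 R h12

/-- **Integrated decay, qualitative form, unconditionally in the data**: under Thm. 3.2 (25) the
local energy of every admissible wave dips below every `ε > 0` at arbitrarily late times — the
statement `drsr_wave_integrated_decay_kerr.frequently_lt` of `KerrWaveDecay.lean` with its
finiteness hypothesis `E₂[ψ](0) < ∞` discharged by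
`IsAdmissibleKerrWave.sliceSobolevEnergy_two_lt_top`. (Superseded by
`drsr_wave_local_energy_decay_kerr_of_integrated_decay`, recorded for users of the weaker form.)
DRSR, arXiv:1402.7034, Thm. 3.2 (25). [cite: DafermosRodnianskiShlapentokhrothman2014, Thm. 3.2 (25)] -/
theorem drsr_wave_integrated_decay_kerr.frequently_lt' (h : drsr_wave_integrated_decay_kerr)
    [Kerr.Facts] [Kerr.SliceFacts] {M a : ℝ} (hMa : Kerr.IsSubextremal M a)
    {ψ : Kerr.exterior M a → ℝ} (hψ : IsAdmissibleKerrWave M a ψ) (R : ℝ) {ε : ℝ≥0∞}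
    (hε : 0 < ε) :
    ∃ᶠ τ in atTop, localSliceEnergy (Kerr.exterior M a) ψ τ R < ε :=
  h.frequently_lt hMa hψ (hψ.sliceSobolevEnergy_two_lt_top hMa.pos.le) R hε

end Literature.Geometry.Lorentzian

end
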